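import Literature.Probability.Percolation.BondTriangularHexBoundary
import Literature.Probability.Percolation.FiniteEnergy
import HarnessLib

/-!
# Exit events of the hexagon argument for bond percolation on `𝕋`: properties and symmetries

Topic `Literature/Probability/Percolation`; theorems only. The events of the hexagon form of
Zhang's argument in the proof of `θ(2 sin(π/18)) = 0` for bond percolation on the triangular
lattice (Bollobás–Riordan, *Percolation* (2006), Ch. 5, proof of Thm. 11, p. 137, with the events
`L_i` of the proof of Thm. 5, p. 127: "some infinite open path leaves `S` from the `i`-th side …
using only bonds outside `S`"): `tExit (hexFinset k) (hexSide k i)` ("an infinite open path of `𝕋`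
leaves the hexagon `H_k` through the side `i`") and `dExit (hexFinset k) (hexSide k i)` ("an
infinite open dual path leaves `H_k` through the side `i`"), `BondTriangularDual.lean`. We prove:

* monotonicity and measurability (`isLowerSet_dExit`, `measurableSet_tExit`, `measurableSet_dExit`);
* both events are **determined by the pairs not inside the hexagon** (`determinedBy_tExit`,
  `determinedBy_dExit`) — B–R: "defined in terms of bonds outside `S`" — so that they are
  independent of the states of the edges inside;
* **exhaustion**: if some site of `H_k` lies in an infinite open cluster then some `tExit` event
  holds (`exists_tExit_of_percolatesAt`), and if some inside corner lies in an infinite open dual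
  cluster then some `dExit` event holds (`exists_dExit_of_percolatesAt`) — "some infinite open path
  leaves `S` from [some] side";
* **symmetries**: the rotation `hexRot k` of `𝕋` carries `tExit` at the side `i` to the side `i + 1`
  (`preimage_relabel_hexRot_tExit`), and the point reflection `z ↦ (2k, 2k) - z` of `𝕋` — acting on
  the dual brick wall by the point reflection `v ↦ (6k + 4, 2k + 1) - v` (`triDual_relabel_reflect`)
  — carries `dExit` at the side `i` to the side `i + 3` (`preimage_relabel_reflect_dExit`).

## References

* B. Bollobás, O. Riordan, *Percolation*, CUP (2006), Ch. 5, proof of Thm. 5 (p. 127) and of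
  Thm. 11 (p. 137). [BollobasRiordan2006]
-/

namespace Literature.Probability.Percolation

namespace BondTri

open LatticeModels TriHexagon SimpleGraph MeasureTheory

-- one uniform coordinate simp set serves the explicit lattice-point identities of this file
set_option linter.unusedSimpArgs false

noncomputable section

/-! ### Monotonicity and measurability -/

/-- The dual configuration is antitone in the configuration. [folklore] -/
theorem triDual_antitone {ω ω' : Set (Sym2 (Site 2))} (h : ω ⊆ ω') : triDual ω' ⊆ triDual ω :=
  fun e he => by
    rw [mem_triDual_iff] at he ⊢
    exact ⟨he.1, fun h' => he.2 (h h')⟩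

/-- The dual exit event is decreasing. [folklore] -/
theorem isLowerSet_dExit (S : Finset (Site 2)) (A : Set (Site 2)) : IsLowerSet (dExit S A) := by
  rintro ω ω' hle ⟨f, a, ha, b, hb, hne, haA, hbA, hc, hperc⟩
  exact ⟨f, a, ha, b, hb, hne, haA, hbA, hc,
    isUpperSet_percolatesVia _ _ (triDual_antitone hle) hperc⟩

/-- The exit event of `𝕋` is measurable. [folklore] -/
theorem measurableSet_tExit (S : Finset (Site 2)) (A : Set (Site 2)) : MeasurableSet (tExit S A) := by
  have h : tExit S A = ⋃ y : Site 2, ⋃ z : Site 2,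
      ({_ω | y ∈ A ∧ z ∉ S ∧ y ≠ z} ∩ {ω | s(y, z) ∈ ω} ∩
        percolatesVia (withinGraph ⊤ (↑S : Set (Site 2))ᶜ) z) := by
    ext ω
    simp only [tExit, Set.mem_setOf_eq, Set.mem_iUnion, Set.mem_inter_iff, openGraph_adj]
    constructor
    · rintro ⟨y, hy, z, hz, ⟨hyz, hne⟩, hp⟩
      exact ⟨y, z, ⟨⟨hy, hz, hne⟩, hyz⟩, hp⟩
    · rintro ⟨y, z, ⟨⟨hy, hz, hne⟩, hyz⟩, hp⟩
      exact ⟨y, hy, z, hz, ⟨hyz, hne⟩, hp⟩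
  rw [h]
  exact MeasurableSet.iUnion fun y => MeasurableSet.iUnion fun z =>
    ((MeasurableSet.const _).inter (measurableSet_mem _)).inter (measurableSet_percolatesVia _ _)

/-- The dual exit event is measurable. [folklore] -/
theorem measurableSet_dExit (S : Finset (Site 2)) (A : Set (Site 2)) : MeasurableSet (dExit S A) := by
  have h : dExit S A = ⋃ f : HexVertex, ⋃ a : Site 2, ⋃ b : Site 2,
      ({_ω | a ∈ hexFaceVertices f ∧ b ∈ hexFaceVertices f ∧ a ≠ b ∧ a ∈ A ∧ b ∈ A ∧
          ∃ c ∈ hexFaceVertices f, c ∉ S} ∩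
        triDual ⁻¹' percolatesVia (withinGraph ⊤ (↑(insideCorners S) : Set (Site 2))ᶜ) (corner f)) := by
    ext ω
    simp only [dExit, Set.mem_setOf_eq, Set.mem_iUnion, Set.mem_inter_iff, Set.mem_preimage]
    constructor
    · rintro ⟨f, a, ha, b, hb, hne, haA, hbA, hc, hp⟩
      exact ⟨f, a, b, ⟨ha, hb, hne, haA, hbA, hc⟩, hp⟩
    · rintro ⟨f, a, b, ⟨ha, hb, hne, haA, hbA, hc⟩, hp⟩
      exact ⟨f, a, ha, b, hb, hne, haA, hbA, hc, hp⟩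
  rw [h]
  exact MeasurableSet.iUnion fun f => MeasurableSet.iUnion fun a => MeasurableSet.iUnion fun b =>
    (MeasurableSet.const _).inter (measurable_triDual (measurableSet_percolatesVia _ _))

/-! ### The exit events are determined by the pairs not inside the hexagon -/

/-- Agreement off a set of pairs gives agreement on every smaller set of pairs. [folklore] -/
theorem inter_eq_inter_of_subset {ω ω' T E : Set (Sym2 (Site 2))} (h : ω ∩ T = ω' ∩ T) (hE : E ⊆ T) :
    ω ∩ E = ω' ∩ E := by
  have hE' : E = T ∩ E := (Set.inter_eq_self_of_subset_right hE).symm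
  rw [hE', ← Set.inter_assoc, ← Set.inter_assoc, h]

/-- **The exit event of `𝕋` is determined by the pairs not inside `S`** ("using only bonds outside
`S`"). [cite: BollobasRiordan2006, Ch. 5, proof of Thm. 5 (p. 127)] -/
theorem determinedBy_tExit (S : Finset (Site 2)) (A : Set (Site 2)) :
    DeterminedBy (tExit S A) (↑S.sym2 : Set (Sym2 (Site 2)))ᶜ := by
  rw [determinedBy_iff]
  have hK : (withinGraph ⊤ (↑S : Set (Site 2))ᶜ).edgeSet ⊆ (↑S.sym2 : Set (Sym2 (Site 2)))ᶜ := by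
    intro e he
    induction e using Sym2.ind with
    | h u v =>
      rw [SimpleGraph.mem_edgeSet, withinGraph_adj] at he
      rw [Set.mem_compl_iff, Finset.mem_coe, Finset.mk_mem_sym2_iff]
      exact fun h => he.2.1 h.1
  have key : ∀ ω ω' : Set (Sym2 (Site 2)), ω ∩ (↑S.sym2 : Set (Sym2 (Site 2)))ᶜ = ω' ∩ (↑S.sym2)ᶜ →
      ω ∈ tExit S A → ω' ∈ tExit S A := by
    rintro ω ω' h ⟨y, hy, z, hz, hadj, hperc⟩
    rw [openGraph_adj] at hadj
    have hyz : s(y, z) ∈ (↑S.sym2 : Set (Sym2 (Site 2)))ᶜ := by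
      rw [Set.mem_compl_iff, Finset.mem_coe, Finset.mk_mem_sym2_iff]
      exact fun h' => hz h'.2
    refine ⟨y, hy, z, hz, ?_, ?_⟩
    · rw [openGraph_adj]
      exact ⟨((Set.ext_iff.1 h s(y, z)).1 ⟨hadj.1, hyz⟩).1, hadj.2⟩
    · exact ((determinedBy_iff _ _).1 (determinedBy_percolatesVia _ z) ω ω'
        (inter_eq_inter_of_subset h hK)).1 hperc
  exact fun ω ω' h => ⟨key ω ω' h, key ω' ω h.symm⟩

/-- **An open dual edge between corners that are not inside `H_k` is the dual of an edge of `𝕋` not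
inside `H_k`**: if `{u, v} = brickWallEdge j` with `u, v ∉ insideCorners (hexFinset k)` then `j`
does not have both endpoints in `H_k` (one face of such an edge would lie inside,
`subset_or_subset_of_adj`). [folklore] -/
theorem not_mem_sym2_of_corners {k : ℕ} {u v : Site 2} (hu : u ∉ insideCorners (hexFinset k))
    (hv : v ∉ insideCorners (hexFinset k)) (d : triGraph.Dart)
    (hd : s(u, v) = s(corner (triEdgeFaces d).1, corner (triEdgeFaces d).2)) :
    d.edge ∉ (hexFinset k).sym2 := by
  intro hmem
  have hd' : d = ⟨(d.fst, d.snd), d.adj⟩ := rfl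
  have hH : ∀ x, x ∈ hexFinset k → x ∈ hexRegion k := fun x hx => by
    rw [← coe_hexFinset]; exact Finset.mem_coe.2 hx
  have h1 : d.fst ∈ hexRegion k := hH _ (Finset.mk_mem_sym2_iff.1 hmem).1
  have h2 : d.snd ∈ hexRegion k := hH _ (Finset.mk_mem_sym2_iff.1 hmem).2
  have hins : ∀ f : HexVertex, (↑(hexFaceVertices f) : Set (Site 2)) ⊆ hexRegion k →
      corner f ∈ insideCorners (hexFinset k) := fun f hf =>
    corner_mem_insideCorners fun x hx => by
      rw [← Finset.mem_coe, coe_hexFinset]; exact hf (Finset.mem_coe.2 hx)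
  rcases Sym2.eq_iff.1 hd with ⟨rfl, rfl⟩ | ⟨rfl, rfl⟩ <;>
    rcases subset_or_subset_of_adj h1 h2 d.adj with h | h
  · exact hu (hins _ (hd' ▸ h))
  · exact hv (hins _ (hd' ▸ h))
  · exact hv (hins _ (hd' ▸ h))
  · exact hu (hins _ (hd' ▸ h))

/-- Configurations agreeing off the pairs inside `H_k` have dual configurations agreeing on the
brick-wall edges between corners not inside `H_k`. [folklore] -/
theorem triDual_inter_eq {k : ℕ} {ω ω' : Set (Sym2 (Site 2))}
    (h : ω ∩ (↑(hexFinset k).sym2 : Set (Sym2 (Site 2)))ᶜ = ω' ∩ (↑(hexFinset k).sym2)ᶜ) :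
    triDual ω ∩ (withinGraph ⊤ (↑(insideCorners (hexFinset k)) : Set (Site 2))ᶜ).edgeSet =
      triDual ω' ∩ (withinGraph ⊤ (↑(insideCorners (hexFinset k)) : Set (Site 2))ᶜ).edgeSet := by
  have key : ∀ ω ω' : Set (Sym2 (Site 2)),
      ω ∩ (↑(hexFinset k).sym2 : Set (Sym2 (Site 2)))ᶜ = ω' ∩ (↑(hexFinset k).sym2)ᶜ →
      ∀ e, e ∈ triDual ω ∩ (withinGraph ⊤ (↑(insideCorners (hexFinset k)) : Set (Site 2))ᶜ).edgeSet →
        e ∈ triDual ω' := by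
    intro ω ω' h e he
    obtain ⟨he, heK⟩ := he
    induction e using Sym2.ind with
    | h u v =>
      rw [SimpleGraph.mem_edgeSet, withinGraph_adj] at heK
      obtain ⟨-, hu, hv⟩ := heK
      obtain ⟨d, hdω, hduv⟩ := exists_dart_of_mem_triDual he
      have hj : d.edge ∈ (↑(hexFinset k).sym2 : Set (Sym2 (Site 2)))ᶜ := by
        rw [Set.mem_compl_iff, Finset.mem_coe]
        exact not_mem_sym2_of_corners hu hv d hduv
      have hdω' : d.edge ∉ ω' := fun h' => hdω ((Set.ext_iff.1 h d.edge).2 ⟨h', hj⟩).1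
      rw [hduv]
      exact (corner_mem_triDual_iff d).2 hdω'
  ext e
  constructor
  · exact fun he => ⟨key ω ω' h e he, he.2⟩
  · exact fun he => ⟨key ω' ω h.symm e he, he.2⟩

/-- **The dual exit event is determined by the pairs not inside `H_k`.** [cite: BollobasRiordan2006, Ch. 5, proof of Thm. 5 (p. 127)] -/
theorem determinedBy_dExit (k : ℕ) (A : Set (Site 2)) :
    DeterminedBy (dExit (hexFinset k) A) (↑(hexFinset k).sym2 : Set (Sym2 (Site 2)))ᶜ := by
  rw [determinedBy_iff]
  have key : ∀ ω ω' : Set (Sym2 (Site 2)),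
      ω ∩ (↑(hexFinset k).sym2 : Set (Sym2 (Site 2)))ᶜ = ω' ∩ (↑(hexFinset k).sym2)ᶜ →
      ω ∈ dExit (hexFinset k) A → ω' ∈ dExit (hexFinset k) A := by
    rintro ω ω' h ⟨f, a, ha, b, hb, hne, haA, hbA, hc, hperc⟩
    refine ⟨f, a, ha, b, hb, hne, haA, hbA, hc, ?_⟩
    exact ((determinedBy_iff _ _).1 (determinedBy_percolatesVia _ (corner f)) (triDual ω) (triDual ω')
      (triDual_inter_eq h)).1 hperc
  exact fun ω ω' h => ⟨key ω ω' h, key ω' ω h.symm⟩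

/-! ### Exhaustion: infinite clusters meeting the hexagon leave it through some side -/

/-- **An infinite open cluster meeting `H_k` leaves it through one of the six sides**: if some site of
`H_k` lies in an infinite open cluster (of a lattice configuration) then `tExit` holds for some
side. [cite: BollobasRiordan2006, Ch. 5, proof of Thm. 5 (p. 127, "some infinite open path leaves S")] -/
theorem exists_tExit_of_percolatesAt {k : ℕ} {ω : BondConfig (Site 2)} (hω : ω ⊆ triGraph.edgeSet)
    {x : Site 2} (hx : x ∈ hexRegion k) (hperc : ω ∈ percolatesAt x) :
    ∃ i : Fin 6, ω ∈ tExit (hexFinset k) (hexSide k i) := by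
  classical
  have hxK : x ∈ hexFinset k := by rw [← Finset.mem_coe, coe_hexFinset]; exact hx
  obtain ⟨a, haK, ⟨y, hyK, hya⟩, -, hpa⟩ := exists_branch_of_percolatesAt (G := triGraph) (hexFinset k) hω hxK hperc
  have hyH : y ∈ hexRegion k := by rw [← coe_hexFinset]; exact Finset.mem_coe.2 hyK
  have haH : a ∉ hexRegion k := by rw [← coe_hexFinset]; exact fun h => haK (Finset.mem_coe.1 h)
  have hadj : triGraph.Adj y a := hω ((openGraph_adj _ _ _).1 hya).1
  obtain ⟨i, hi⟩ := exists_mem_hexSide_of_adj hyH haH hadj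
  exact ⟨i, y, hi, a, haK, hya, hpa⟩

/-- **An infinite open dual cluster containing an inside corner of `H_k` leaves `H_k` through one of
the six sides** (`dExit` for some side): the first dual edge out of the inside corners crosses a
boundary edge of `𝕋` whose outer face has a vertex outside `H_k`, so its two endpoints in `H_k`
lie on a common side. [cite: BollobasRiordan2006, Ch. 5, proof of Thm. 11 (p. 137)] -/
theorem exists_dExit_of_percolatesAt {k : ℕ} {ω : BondConfig (Site 2)}
    {v : Site 2} (hv : v ∈ insideCorners (hexFinset k)) (hperc : triDual ω ∈ percolatesAt v) :
    ∃ i : Fin 6, ω ∈ dExit (hexFinset k) (hexSide k i) := by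
  classical
  obtain ⟨a, haK, ⟨u, huK, hua⟩, -, hpa⟩ :=
    exists_branch_of_percolatesAt (G := bwGraph) (insideCorners (hexFinset k)) (triDual_subset ω) hv hperc
  have he : s(u, a) ∈ triDual ω := ((openGraph_adj _ _ _).1 hua).1
  obtain ⟨f, hfa, x, hx, y, hy, hxy, hxS, hyS, -, c, hc, hcS⟩ := exists_face_of_exit huK haK he
  have hxH : x ∈ hexRegion k := by rw [← coe_hexFinset]; exact Finset.mem_coe.2 hxS
  have hyH : y ∈ hexRegion k := by rw [← coe_hexFinset]; exact Finset.mem_coe.2 hyS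
  have hcH : c ∉ hexRegion k := by rw [← coe_hexFinset]; exact fun h => hcS (Finset.mem_coe.1 h)
  have hxc : x ≠ c := fun h => hcS (h ▸ hxS)
  have hyc : y ≠ c := fun h => hcS (h ▸ hyS)
  obtain ⟨i, hxi, hyi⟩ := exists_hexSide_of_outer_triangle hxH hyH hcH
    (adj_of_mem_hexFaceVertices hx hc hxc) (adj_of_mem_hexFaceVertices hy hc hyc)
  exact ⟨i, f, x, hx, y, hy, hxy, hxi, hyi, ⟨c, hc, hcS⟩, hfa ▸ hpa⟩


/-! ### Equivariance of the dual configuration -/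

/-- **Equivariance of the dual configuration.** If a bijection `R` of the sites of `𝕋` preserving
adjacency and a bijection `R'` of the plane satisfy `brickWallEdge (R j) = R' (brickWallEdge j)`
for every edge `j` of `𝕋`, then the dual configuration of the relabelled configuration is the
relabelled dual configuration. [folklore] -/
theorem triDual_relabel_of_equivariant (R R' : Site 2 ≃ Site 2)
    (hR : ∀ x y, triGraph.Adj (R x) (R y) ↔ triGraph.Adj x y)
    (hRR' : ∀ j ∈ triGraph.edgeSet, brickWallEdge (Sym2.map R j) = Sym2.map R' (brickWallEdge j))
    (ω : Set (Sym2 (Site 2))) :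
    triDual (BondConfig.relabel (sym2Equiv R) ω) = BondConfig.relabel (sym2Equiv R') (triDual ω) := by
  have hmapR : ∀ j, Sym2.map R j ∈ triGraph.edgeSet ↔ j ∈ triGraph.edgeSet := fun j => by
    induction j using Sym2.ind with
    | h x y => rw [Sym2.map_mk, SimpleGraph.mem_edgeSet, SimpleGraph.mem_edgeSet, hR]
  have hmapRs : ∀ j, Sym2.map R.symm j ∈ triGraph.edgeSet ↔ j ∈ triGraph.edgeSet := fun j => by
    rw [← hmapR, Sym2.map_map, Equiv.self_comp_symm, Sym2.map_id, id]
  have hRR's : ∀ j ∈ triGraph.edgeSet,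
      brickWallEdge (Sym2.map R.symm j) = Sym2.map R'.symm (brickWallEdge j) := by
    intro j hj
    have h := hRR' (Sym2.map R.symm j) ((hmapRs j).2 hj)
    rw [Sym2.map_map, Equiv.self_comp_symm, Sym2.map_id, id] at h
    rw [h, Sym2.map_map, Equiv.symm_comp_self, Sym2.map_id, id]
  ext e
  simp only [BondConfig.mem_relabel_iff, sym2Equiv_symm, sym2Equiv_apply]
  constructor
  · intro he
    obtain ⟨hbw, hcl⟩ := mem_triDual_iff.1 he
    obtain ⟨j, hj, rfl⟩ := exists_brickWallEdge_eq hbw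
    rw [invFunOn_brickWallEdge hj, BondConfig.mem_relabel_iff, sym2Equiv_symm, sym2Equiv_apply] at hcl
    rw [← hRR's j hj, brickWallEdge_mem_triDual_iff ((hmapRs j).2 hj)]
    exact hcl
  · intro he
    obtain ⟨hbw, -⟩ := mem_triDual_iff.1 he
    obtain ⟨j', hj', hje⟩ := exists_brickWallEdge_eq hbw
    have hclosed : j' ∉ ω := by rw [← brickWallEdge_mem_triDual_iff hj', hje]; exact he
    have he' : e = brickWallEdge (Sym2.map R j') := by
      rw [hRR' j' hj', hje, Sym2.map_map, Equiv.self_comp_symm, Sym2.map_id, id]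
    rw [he', brickWallEdge_mem_triDual_iff ((hmapR j').2 hj'), BondConfig.mem_relabel_iff,
      sym2Equiv_symm, sym2Equiv_apply, Sym2.map_map, Equiv.symm_comp_self, Sym2.map_id, id]
    exact hclosed

/-- **Translations**: shifting `𝕋` by `a` shifts the dual brick wall by `(2a₀ + a₁, a₁)`.
[folklore] -/
theorem triDual_relabel_shift (a : Site 2) (ω : Set (Sym2 (Site 2))) :
    triDual (BondConfig.relabel (sym2Equiv (Site.shift a)) ω) =
      BondConfig.relabel (sym2Equiv (Site.shift ![2 * a 0 + a 1, a 1])) (triDual ω) := by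
  refine triDual_relabel_of_equivariant _ _ (fun x y => triGraph_adj_shift_iff a x y) (fun j hj => ?_) ω
  obtain ⟨t, rfl | rfl | rfl⟩ := exists_eq_of_mem_edgeSet hj
  · have h : Sym2.map (Site.shift a) s(t, t + Pi.single 0 1) = s(t + a, (t + a) + Pi.single 0 1) := by
      rw [Sym2.map_mk]; congr 1; exact Site.eq_iff_two.2 ⟨by (rw [← sub_eq_zero]; simp only [Pi.add_apply, Pi.neg_apply, Pi.sub_apply, single_zero_apply_zero, single_zero_apply_one, single_one_apply_zero, single_one_apply_one, triDiag_zero, triDiag_one, Matrix.cons_val_zero, Matrix.cons_val_one, Matrix.head_cons, Matrix.cons_val_fin_one, Site.shift_apply, Equiv.subLeft_apply, neg_zero, add_zero, sub_zero]; omega), by (rw [← sub_eq_zero]; simp only [Pi.add_apply, Pi.neg_apply, Pi.sub_apply, single_zero_apply_zero, single_zero_apply_one, single_one_apply_zero, single_one_apply_one, triDiag_zero, triDiag_one, Matrix.cons_val_zero, Matrix.cons_val_one, Matrix.head_cons, Matrix.cons_val_fin_one, Site.shift_apply, Equiv.subLeft_apply, neg_zero, add_zero, sub_zero]; omega)⟩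
    rw [h, brickWallEdge_horizontal, brickWallEdge_horizontal, Sym2.map_mk]
    congr 1 <;> exact Site.eq_iff_two.2 ⟨by (rw [← sub_eq_zero]; simp only [Pi.add_apply, Pi.neg_apply, Pi.sub_apply, single_zero_apply_zero, single_zero_apply_one, single_one_apply_zero, single_one_apply_one, triDiag_zero, triDiag_one, Matrix.cons_val_zero, Matrix.cons_val_one, Matrix.head_cons, Matrix.cons_val_fin_one, Site.shift_apply, Equiv.subLeft_apply, neg_zero, add_zero, sub_zero]; omega), by (rw [← sub_eq_zero]; simp only [Pi.add_apply, Pi.neg_apply, Pi.sub_apply, single_zero_apply_zero, single_zero_apply_one, single_one_apply_zero, single_one_apply_one, triDiag_zero, triDiag_one, Matrix.cons_val_zero, Matrix.cons_val_one, Matrix.head_cons, Matrix.cons_val_fin_one, Site.shift_apply, Equiv.subLeft_apply, neg_zero, add_zero, sub_zero]; omega)⟩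
  · have h : Sym2.map (Site.shift a) s(t, t + Pi.single 1 1) = s(t + a, (t + a) + Pi.single 1 1) := by
      rw [Sym2.map_mk]; congr 1; exact Site.eq_iff_two.2 ⟨by (rw [← sub_eq_zero]; simp only [Pi.add_apply, Pi.neg_apply, Pi.sub_apply, single_zero_apply_zero, single_zero_apply_one, single_one_apply_zero, single_one_apply_one, triDiag_zero, triDiag_one, Matrix.cons_val_zero, Matrix.cons_val_one, Matrix.head_cons, Matrix.cons_val_fin_one, Site.shift_apply, Equiv.subLeft_apply, neg_zero, add_zero, sub_zero]; omega), by (rw [← sub_eq_zero]; simp only [Pi.add_apply, Pi.neg_apply, Pi.sub_apply, single_zero_apply_zero, single_zero_apply_one, single_one_apply_zero, single_one_apply_one, triDiag_zero, triDiag_one, Matrix.cons_val_zero, Matrix.cons_val_one, Matrix.head_cons, Matrix.cons_val_fin_one, Site.shift_apply, Equiv.subLeft_apply, neg_zero, add_zero, sub_zero]; omega)⟩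
    rw [h, brickWallEdge_vertical, brickWallEdge_vertical, Sym2.map_mk]
    congr 1 <;> exact Site.eq_iff_two.2 ⟨by (rw [← sub_eq_zero]; simp only [Pi.add_apply, Pi.neg_apply, Pi.sub_apply, single_zero_apply_zero, single_zero_apply_one, single_one_apply_zero, single_one_apply_one, triDiag_zero, triDiag_one, Matrix.cons_val_zero, Matrix.cons_val_one, Matrix.head_cons, Matrix.cons_val_fin_one, Site.shift_apply, Equiv.subLeft_apply, neg_zero, add_zero, sub_zero]; omega), by (rw [← sub_eq_zero]; simp only [Pi.add_apply, Pi.neg_apply, Pi.sub_apply, single_zero_apply_zero, single_zero_apply_one, single_one_apply_zero, single_one_apply_one, triDiag_zero, triDiag_one, Matrix.cons_val_zero, Matrix.cons_val_one, Matrix.head_cons, Matrix.cons_val_fin_one, Site.shift_apply, Equiv.subLeft_apply, neg_zero, add_zero, sub_zero]; omega)⟩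
  · have h : Sym2.map (Site.shift a) s(t, t - Pi.single 0 1 + Pi.single 1 1) =
        s(t + a, (t + a) - Pi.single 0 1 + Pi.single 1 1) := by
      rw [Sym2.map_mk]; congr 1; exact Site.eq_iff_two.2 ⟨by (rw [← sub_eq_zero]; simp only [Pi.add_apply, Pi.neg_apply, Pi.sub_apply, single_zero_apply_zero, single_zero_apply_one, single_one_apply_zero, single_one_apply_one, triDiag_zero, triDiag_one, Matrix.cons_val_zero, Matrix.cons_val_one, Matrix.head_cons, Matrix.cons_val_fin_one, Site.shift_apply, Equiv.subLeft_apply, neg_zero, add_zero, sub_zero]; omega), by (rw [← sub_eq_zero]; simp only [Pi.add_apply, Pi.neg_apply, Pi.sub_apply, single_zero_apply_zero, single_zero_apply_one, single_one_apply_zero, single_one_apply_one, triDiag_zero, triDiag_one, Matrix.cons_val_zero, Matrix.cons_val_one, Matrix.head_cons, Matrix.cons_val_fin_one, Site.shift_apply, Equiv.subLeft_apply, neg_zero, add_zero, sub_zero]; omega)⟩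
    rw [h, brickWallEdge_diagonal, brickWallEdge_diagonal, Sym2.map_mk]
    congr 1 <;> exact Site.eq_iff_two.2 ⟨by (rw [← sub_eq_zero]; simp only [Pi.add_apply, Pi.neg_apply, Pi.sub_apply, single_zero_apply_zero, single_zero_apply_one, single_one_apply_zero, single_one_apply_one, triDiag_zero, triDiag_one, Matrix.cons_val_zero, Matrix.cons_val_one, Matrix.head_cons, Matrix.cons_val_fin_one, Site.shift_apply, Equiv.subLeft_apply, neg_zero, add_zero, sub_zero]; omega), by (rw [← sub_eq_zero]; simp only [Pi.add_apply, Pi.neg_apply, Pi.sub_apply, single_zero_apply_zero, single_zero_apply_one, single_one_apply_zero, single_one_apply_one, triDiag_zero, triDiag_one, Matrix.cons_val_zero, Matrix.cons_val_one, Matrix.head_cons, Matrix.cons_val_fin_one, Site.shift_apply, Equiv.subLeft_apply, neg_zero, add_zero, sub_zero]; omega)⟩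

/-- The point reflection `z ↦ (2k, 2k) - z` preserves adjacency of `𝕋`. [folklore] -/
theorem triGraph_adj_reflect_iff (k : ℕ) (x y : Site 2) :
    triGraph.Adj ((![2 * (k : ℤ), 2 * k] : Site 2) - x) (![2 * (k : ℤ), 2 * k] - y) ↔ triGraph.Adj x y := by
  rw [triGraph_adj_iff_brick, triGraph_adj_iff_brick]
  simp only [brickX, Pi.sub_apply, Matrix.cons_val_zero, Matrix.cons_val_one, Matrix.cons_val_fin_one]
  omega

/-- **Point reflection**: reflecting `𝕋` in the centre `(k, k)` of the hexagon, `z ↦ (2k, 2k) - z`,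
reflects the dual brick wall in the point `(3k + 2, k + 1/2)`, `v ↦ (6k + 4, 2k + 1) - v`. [folklore] -/
theorem triDual_relabel_reflect (k : ℕ) (ω : Set (Sym2 (Site 2))) :
    triDual (BondConfig.relabel (sym2Equiv (Equiv.subLeft (![2 * (k : ℤ), 2 * k] : Site 2))) ω) =
      BondConfig.relabel (sym2Equiv (Equiv.subLeft (![6 * (k : ℤ) + 4, 2 * k + 1] : Site 2)))
        (triDual ω) := by
  refine triDual_relabel_of_equivariant _ _ (fun x y => triGraph_adj_reflect_iff k x y)
    (fun j hj => ?_) ω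
  obtain ⟨t, rfl | rfl | rfl⟩ := exists_eq_of_mem_edgeSet hj
  · -- `{t, t + e₀} ↦ {c - t, c - t - e₀}`, the horizontal edge of the cell `c - t - e₀`
    have h : Sym2.map (Equiv.subLeft (![2 * (k : ℤ), 2 * k] : Site 2)) s(t, t + Pi.single 0 1) =
        s((![2 * (k : ℤ), 2 * k] : Site 2) - t - Pi.single 0 1, ((![2 * (k : ℤ), 2 * k] : Site 2) - t - Pi.single 0 1) + Pi.single 0 1) := by
      rw [Sym2.map_mk, Sym2.eq_swap]; congr 1 <;> exact Site.eq_iff_two.2 ⟨by (rw [← sub_eq_zero]; simp only [Pi.add_apply, Pi.neg_apply, Pi.sub_apply, single_zero_apply_zero, single_zero_apply_one, single_one_apply_zero, single_one_apply_one, triDiag_zero, triDiag_one, Matrix.cons_val_zero, Matrix.cons_val_one, Matrix.head_cons, Matrix.cons_val_fin_one, Site.shift_apply, Equiv.subLeft_apply, neg_zero, add_zero, sub_zero]; omega), by (rw [← sub_eq_zero]; simp only [Pi.add_apply, Pi.neg_apply, Pi.sub_apply, single_zero_apply_zero, single_zero_apply_one, single_one_apply_zero, single_one_apply_one, triDiag_zero,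 triDiag_one, Matrix.cons_val_zero, Matrix.cons_val_one, Matrix.head_cons, Matrix.cons_val_fin_one, Site.shift_apply, Equiv.subLeft_apply, neg_zero, add_zero, sub_zero]; omega)⟩
    rw [h, brickWallEdge_horizontal, brickWallEdge_horizontal, Sym2.map_mk, Sym2.eq_swap]
    congr 1 <;> exact Site.eq_iff_two.2 ⟨by (rw [← sub_eq_zero]; simp only [Pi.add_apply, Pi.neg_apply, Pi.sub_apply, single_zero_apply_zero, single_zero_apply_one, single_one_apply_zero, single_one_apply_one, triDiag_zero, triDiag_one, Matrix.cons_val_zero, Matrix.cons_val_one, Matrix.head_cons, Matrix.cons_val_fin_one, Site.shift_apply, Equiv.subLeft_apply, neg_zero, add_zero, sub_zero]; omega), by (rw [← sub_eq_zero]; simp only [Pi.add_apply, Pi.neg_apply, Pi.sub_apply, single_zero_apply_zero, single_zero_apply_one, single_one_apply_zero, single_one_apply_one, triDiag_zero, triDiag_one, Matrix.cons_val_zero, Matrix.cons_val_one, Matrix.head_cons, Matrix.cons_val_fin_one, Site.shift_apply, Equiv.subLeft_apply, neg_zero, add_zero, sub_zero]; omega)⟩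
  · have h : Sym2.map (Equiv.subLeft (![2 * (k : ℤ), 2 * k] : Site 2)) s(t, t + Pi.single 1 1) =
        s((![2 * (k : ℤ), 2 * k] : Site 2) - t - Pi.single 1 1, ((![2 * (k : ℤ), 2 * k] : Site 2) - t - Pi.single 1 1) + Pi.single 1 1) := by
      rw [Sym2.map_mk, Sym2.eq_swap]; congr 1 <;> exact Site.eq_iff_two.2 ⟨by (rw [← sub_eq_zero]; simp only [Pi.add_apply, Pi.neg_apply, Pi.sub_apply, single_zero_apply_zero, single_zero_apply_one, single_one_apply_zero, single_one_apply_one, triDiag_zero, triDiag_one, Matrix.cons_val_zero, Matrix.cons_val_one, Matrix.head_cons, Matrix.cons_val_fin_one, Site.shift_apply, Equiv.subLeft_apply, neg_zero, add_zero, sub_zero]; omega), by (rw [← sub_eq_zero]; simp only [Pi.add_apply, Pi.neg_apply, Pi.sub_apply, single_zero_apply_zero, single_zero_apply_one, single_one_apply_zero, single_one_apply_one, triDiag_zero, triDiag_one, Matrix.cons_val_zero, Matrix.cons_val_one, Matrix.head_cons, Matrix.cons_val_fin_one, Site.shift_apply, Equiv.subLeft_apply, neg_zero, add_zero, sub_zero];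 omega)⟩
    rw [h, brickWallEdge_vertical, brickWallEdge_vertical, Sym2.map_mk, Sym2.eq_swap]
    congr 1 <;> exact Site.eq_iff_two.2 ⟨by (rw [← sub_eq_zero]; simp only [Pi.add_apply, Pi.neg_apply, Pi.sub_apply, single_zero_apply_zero, single_zero_apply_one, single_one_apply_zero, single_one_apply_one, triDiag_zero, triDiag_one, Matrix.cons_val_zero, Matrix.cons_val_one, Matrix.head_cons, Matrix.cons_val_fin_one, Site.shift_apply, Equiv.subLeft_apply, neg_zero, add_zero, sub_zero]; omega), by (rw [← sub_eq_zero]; simp only [Pi.add_apply, Pi.neg_apply, Pi.sub_apply, single_zero_apply_zero, single_zero_apply_one, single_one_apply_zero, single_one_apply_one, triDiag_zero, triDiag_one, Matrix.cons_val_zero, Matrix.cons_val_one, Matrix.head_cons, Matrix.cons_val_fin_one, Site.shift_apply, Equiv.subLeft_apply, neg_zero, add_zero, sub_zero]; omega)⟩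
  · have h : Sym2.map (Equiv.subLeft (![2 * (k : ℤ), 2 * k] : Site 2)) s(t, t - Pi.single 0 1 + Pi.single 1 1) =
        s((![2 * (k : ℤ), 2 * k] : Site 2) - t + Pi.single 0 1 - Pi.single 1 1,
          ((![2 * (k : ℤ), 2 * k] : Site 2) - t + Pi.single 0 1 - Pi.single 1 1) - Pi.single 0 1 + Pi.single 1 1) := by
      rw [Sym2.map_mk, Sym2.eq_swap]; congr 1 <;> exact Site.eq_iff_two.2 ⟨by (rw [← sub_eq_zero]; simp only [Pi.add_apply, Pi.neg_apply, Pi.sub_apply, single_zero_apply_zero, single_zero_apply_one, single_one_apply_zero, single_one_apply_one, triDiag_zero, triDiag_one, Matrix.cons_val_zero, Matrix.cons_val_one, Matrix.head_cons, Matrix.cons_val_fin_one, Site.shift_apply, Equiv.subLeft_apply, neg_zero, add_zero, sub_zero]; omega), by (rw [← sub_eq_zero]; simp only [Pi.add_apply, Pi.neg_apply, Pi.sub_apply, single_zero_apply_zero, single_zero_apply_one, single_one_apply_zero, single_one_apply_one, triDiag_zero, triDiag_one, Matrix.cons_val_zero, Matrix.cons_val_one, Matrix.head_cons, Matrix.cons_val_fin_one,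 Site.shift_apply, Equiv.subLeft_apply, neg_zero, add_zero, sub_zero]; omega)⟩
    rw [h, brickWallEdge_diagonal, brickWallEdge_diagonal, Sym2.map_mk, Sym2.eq_swap]
    congr 1 <;> exact Site.eq_iff_two.2 ⟨by (rw [← sub_eq_zero]; simp only [Pi.add_apply, Pi.neg_apply, Pi.sub_apply, single_zero_apply_zero, single_zero_apply_one, single_one_apply_zero, single_one_apply_one, triDiag_zero, triDiag_one, Matrix.cons_val_zero, Matrix.cons_val_one, Matrix.head_cons, Matrix.cons_val_fin_one, Site.shift_apply, Equiv.subLeft_apply, neg_zero, add_zero, sub_zero]; omega), by (rw [← sub_eq_zero]; simp only [Pi.add_apply, Pi.neg_apply, Pi.sub_apply, single_zero_apply_zero, single_zero_apply_one, single_one_apply_zero, single_one_apply_one, triDiag_zero, triDiag_one, Matrix.cons_val_zero, Matrix.cons_val_one, Matrix.head_cons, Matrix.cons_val_fin_one, Site.shift_apply, Equiv.subLeft_apply, neg_zero, add_zero, sub_zero]; omega)⟩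

/-! ### The rotation carries the exit event of `𝕋` from side to side -/

/-- **Rotating the exit event of `𝕋`**: `ω ↦ hexRot k '' ω` carries `tExit` through the side `i`
onto `tExit` through the side `i + 1`. [folklore] -/
theorem preimage_relabel_hexRot_tExit (k : ℕ) (i : Fin 6) :
    BondConfig.relabel (sym2Equiv (hexRot k)) ⁻¹' tExit (hexFinset k) (hexSide k (i + 1)) =
      tExit (hexFinset k) (hexSide k i) := by
  have hK : ∀ u v, (withinGraph ⊤ (↑(hexFinset k) : Set (Site 2))ᶜ).Adj (hexRot k u) (hexRot k v) ↔
      (withinGraph ⊤ (↑(hexFinset k) : Set (Site 2))ᶜ).Adj u v := fun u v => by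
    simp only [withinGraph_adj, top_adj, ne_eq, (hexRot k).injective.eq_iff, Set.mem_compl_iff,
      coe_hexFinset, hexRot_mem_hexRegion_iff]
  ext ω
  simp only [Set.mem_preimage, tExit, Set.mem_setOf_eq]
  constructor
  · rintro ⟨y, hy, z, hz, hadj, hperc⟩
    refine ⟨(hexRot k).symm y, ?_, (hexRot k).symm z, ?_, ?_, ?_⟩
    · rw [← hexRot_mem_hexSide_iff k, Equiv.apply_symm_apply]; exact hy
    · rw [mem_hexFinset, ← hexRot_mem_hexRegion_iff k, Equiv.apply_symm_apply, ← mem_hexFinset]; exact hz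
    · rw [← openGraph_relabel_adj_iff (hexRot k), Equiv.apply_symm_apply, Equiv.apply_symm_apply]
      exact hadj
    · rw [← relabel_mem_percolatesVia_iff (hexRot k) hK, Equiv.apply_symm_apply]; exact hperc
  · rintro ⟨y, hy, z, hz, hadj, hperc⟩
    refine ⟨hexRot k y, (hexRot_mem_hexSide_iff k i).2 hy, hexRot k z, ?_, ?_, ?_⟩
    · rw [mem_hexFinset, hexRot_mem_hexRegion_iff, ← mem_hexFinset]; exact hz
    · rw [openGraph_relabel_adj_iff]; exact hadj
    · rw [relabel_mem_percolatesVia_iff (hexRot k) hK]; exact hperc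

/-- All six exit events of `𝕋` have the same probability. [cite: BollobasRiordan2006, Ch. 5, proof of Thm. 5 (p. 127, "by symmetry")] -/
theorem real_tExit_succ (p : unitInterval) (k : ℕ) (i : Fin 6) :
    (bondPercolation triGraph p).real (tExit (hexFinset k) (hexSide k (i + 1))) =
      (bondPercolation triGraph p).real (tExit (hexFinset k) (hexSide k i)) := by
  rw [← preimage_relabel_hexRot_tExit k i]
  exact (bondPercolation_real_preimage_relabel_iso (hexRotIso k) p _).symm

open Fin.NatCast in
/-- All six exit events of `𝕋` have the probability of the first. [folklore] -/
theorem real_tExit_eq (p : unitInterval) (k : ℕ) (i : Fin 6) :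
    (bondPercolation triGraph p).real (tExit (hexFinset k) (hexSide k i)) =
      (bondPercolation triGraph p).real (tExit (hexFinset k) (hexSide k 0)) := by
  have h : ∀ n : ℕ, (bondPercolation triGraph p).real (tExit (hexFinset k) (hexSide k (n : Fin 6))) =
      (bondPercolation triGraph p).real (tExit (hexFinset k) (hexSide k 0)) := by
    intro n
    induction n with
    | zero => simp
    | succ n ih => rw [Nat.cast_succ, real_tExit_succ, ih]
  rw [← Fin.cast_val_eq_self i]
  exact h i.val

/-! ### The point reflection carries the dual exit event to the opposite side -/

/-- The hexagon is symmetric under the point reflection. [folklore] -/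
theorem sub_mem_hexRegion_iff {k : ℕ} {x : Site 2} :
    (![2 * (k : ℤ), 2 * k] : Site 2) - x ∈ hexRegion k ↔ x ∈ hexRegion k := by
  simp only [mem_hexRegion, Pi.sub_apply, Matrix.cons_val_zero, Matrix.cons_val_one,
    Matrix.cons_val_fin_one]
  omega

/-- The point reflection maps the side `i` onto the opposite side `i + 3`. [folklore] -/
theorem sub_mem_hexSide_iff {k : ℕ} {x : Site 2} (i : Fin 6) :
    (![2 * (k : ℤ), 2 * k] : Site 2) - x ∈ hexSide k (i + 3) ↔ x ∈ hexSide k i := by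
  fin_cases i <;>
  simp only [hexSide, Fin.zero_eta, Fin.mk_one, Fin.reduceFinMk, Fin.isValue, Fin.reduceAdd,
    Set.mem_setOf_eq, mem_hexRegion, Pi.sub_apply, Matrix.cons_val_zero, Matrix.cons_val_one,
    Matrix.cons_val_fin_one] <;> omega

/-- **The point reflection acts on faces**: the reflected face has the reflected vertices and the
reflected corner (`(t, 0) ↦ ((2k, 2k) - t - e₀ - e₁, 1)`, `(t, 1) ↦ ((2k, 2k) - t - e₀ - e₁, 0)`). [folklore] -/
theorem exists_reflect_face (k : ℕ) (f : HexVertex) :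
    ∃ f' : HexVertex, (∀ x, x ∈ hexFaceVertices f' ↔ (![2 * (k : ℤ), 2 * k] : Site 2) - x ∈ hexFaceVertices f) ∧
      corner f' = (![6 * (k : ℤ) + 4, 2 * k + 1] : Site 2) - corner f := by
  obtain ⟨t, j⟩ := f
  fin_cases j
  · refine ⟨(![2 * (k : ℤ), 2 * k] - t - Pi.single 0 1 - Pi.single 1 1, 1), fun x => ?_, ?_⟩
    · simp only [hexFaceVertices, Fin.isValue, one_ne_zero, ↓reduceIte, Fin.zero_eta, Finset.mem_insert,
        Finset.mem_singleton, Site.eq_iff_two, Pi.add_apply, Pi.sub_apply, single_zero_apply_zero,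
        single_zero_apply_one, single_one_apply_zero, single_one_apply_one, Matrix.cons_val_zero,
        Matrix.cons_val_one, Matrix.cons_val_fin_one]
      omega
    · exact Site.eq_iff_two.2 ⟨by (rw [← sub_eq_zero]; simp only [corner_apply_zero, corner_apply_one, Fin.isValue, Fin.val_zero, Fin.val_one, Nat.cast_zero, Nat.cast_one, Pi.add_apply, Pi.neg_apply, Pi.sub_apply, single_zero_apply_zero, single_zero_apply_one, single_one_apply_zero, single_one_apply_one, triDiag_zero, triDiag_one, Matrix.cons_val_zero, Matrix.cons_val_one, Matrix.head_cons, Matrix.cons_val_fin_one, Site.shift_apply, Equiv.subLeft_apply, neg_zero, add_zero, sub_zero]; omega), by (rw [← sub_eq_zero]; simp only [corner_apply_zero, corner_apply_one, Fin.isValue, Fin.val_zero, Fin.val_one, Nat.cast_zero, Nat.cast_one, Pi.add_apply, Pi.neg_apply, Pi.sub_apply, single_zero_apply_zero, single_zero_apply_one, single_one_apply_zero, single_one_apply_one, triDiag_zero, triDiag_one, Matrix.cons_val_zero, Matrix.cons_val_one, Matrix.head_cons, Matrix.cons_val_fin_one, Site.shift_apply, Equiv.subLeft_apply, neg_zero,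 add_zero, sub_zero]; omega)⟩
  · refine ⟨(![2 * (k : ℤ), 2 * k] - t - Pi.single 0 1 - Pi.single 1 1, 0), fun x => ?_, ?_⟩
    · simp only [hexFaceVertices, Fin.isValue, ↓reduceIte, Fin.mk_one, one_ne_zero, Finset.mem_insert,
        Finset.mem_singleton, Site.eq_iff_two, Pi.add_apply, Pi.sub_apply, single_zero_apply_zero,
        single_zero_apply_one, single_one_apply_zero, single_one_apply_one, Matrix.cons_val_zero,
        Matrix.cons_val_one, Matrix.cons_val_fin_one]
      omega
    · exact Site.eq_iff_two.2 ⟨by (rw [← sub_eq_zero]; simp only [corner_apply_zero, corner_apply_one, Fin.isValue, Fin.val_zero, Fin.val_one, Nat.cast_zero, Nat.cast_one, Pi.add_apply, Pi.neg_apply, Pi.sub_apply, single_zero_apply_zero, single_zero_apply_one, single_one_apply_zero, single_one_apply_one, triDiag_zero, triDiag_one, Matrix.cons_val_zero, Matrix.cons_val_one, Matrix.head_cons, Matrix.cons_val_fin_one, Site.shift_apply, Equiv.subLeft_apply, neg_zero, add_zero, sub_zero]; omega), by (rw [← sub_eq_zero]; simp only [corner_apply_zero, corner_apply_one, Fin.isValue,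 Fin.val_zero, Fin.val_one, Nat.cast_zero, Nat.cast_one, Pi.add_apply, Pi.neg_apply, Pi.sub_apply, single_zero_apply_zero, single_zero_apply_one, single_one_apply_zero, single_one_apply_one, triDiag_zero, triDiag_one, Matrix.cons_val_zero, Matrix.cons_val_one, Matrix.head_cons, Matrix.cons_val_fin_one, Site.shift_apply, Equiv.subLeft_apply, neg_zero, add_zero, sub_zero]; omega)⟩

/-- The inside corners of the hexagon are symmetric under the dual point reflection. [folklore] -/
theorem sub_mem_insideCorners {k : ℕ} {v : Site 2} (hv : v ∈ insideCorners (hexFinset k)) :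
    (![6 * (k : ℤ) + 4, 2 * k + 1] : Site 2) - v ∈ insideCorners (hexFinset k) := by
  obtain ⟨f, hf, rfl⟩ := mem_insideCorners.1 hv
  obtain ⟨f', hf', hc⟩ := exists_reflect_face k f
  rw [← hc]
  refine corner_mem_insideCorners fun x hx => ?_
  rw [mem_hexFinset, ← sub_mem_hexRegion_iff, ← mem_hexFinset]
  exact hf ((hf' x).1 hx)

/-- The inside corners of the hexagon are symmetric under the dual point reflection (iff form). [folklore] -/
theorem sub_mem_insideCorners_iff {k : ℕ} {v : Site 2} :
    (![6 * (k : ℤ) + 4, 2 * k + 1] : Site 2) - v ∈ insideCorners (hexFinset k) ↔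
      v ∈ insideCorners (hexFinset k) := by
  refine ⟨fun h => ?_, sub_mem_insideCorners⟩
  have := sub_mem_insideCorners h
  rwa [sub_sub_cancel] at this

/-- One direction of the reflection of the dual exit event. [folklore] -/
theorem dExit_of_relabel_reflect {k : ℕ} {i : Fin 6} {ω : BondConfig (Site 2)}
    (h : BondConfig.relabel (sym2Equiv (Equiv.subLeft (![2 * (k : ℤ), 2 * k] : Site 2))) ω ∈
      dExit (hexFinset k) (hexSide k i)) :
    ω ∈ dExit (hexFinset k) (hexSide k (i + 3)) := by
  set c : Site 2 := ![2 * (k : ℤ), 2 * k] with hc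
  set C : Site 2 := ![6 * (k : ℤ) + 4, 2 * k + 1] with hC
  have hK : ∀ u v, (withinGraph ⊤ (↑(insideCorners (hexFinset k)) : Set (Site 2))ᶜ).Adj
      (Equiv.subLeft C u) (Equiv.subLeft C v) ↔
      (withinGraph ⊤ (↑(insideCorners (hexFinset k)) : Set (Site 2))ᶜ).Adj u v := fun u v => by
    simp only [withinGraph_adj, top_adj, ne_eq, Set.mem_compl_iff, Finset.mem_coe, Equiv.subLeft_apply, hC,
      sub_right_inj, sub_mem_insideCorners_iff]
  obtain ⟨f, a, ha, b, hb, hne, haA, hbA, ⟨c', hc', hc'S⟩, hperc⟩ := h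
  rw [triDual_relabel_reflect] at hperc
  have hperc' : triDual ω ∈ percolatesVia
      (withinGraph ⊤ (↑(insideCorners (hexFinset k)) : Set (Site 2))ᶜ) (C - corner f) := by
    have h' := (relabel_mem_percolatesVia_iff (Equiv.subLeft C) hK (triDual ω) (C - corner f))
    rw [Equiv.subLeft_apply, sub_sub_cancel] at h'
    exact h'.1 hperc
  obtain ⟨f', hf', hcf'⟩ := exists_reflect_face k f
  refine ⟨f', c - a, (hf' _).2 (by rwa [sub_sub_cancel]), c - b, (hf' _).2 (by rwa [sub_sub_cancel]),
    fun h => hne (sub_right_injective h), (sub_mem_hexSide_iff i).2 haA, (sub_mem_hexSide_iff i).2 hbA,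
    ⟨c - c', (hf' _).2 (by rwa [sub_sub_cancel]), fun h => hc'S ?_⟩, ?_⟩
  · rw [mem_hexFinset] at h ⊢
    exact sub_mem_hexRegion_iff.1 h
  · rw [hcf']; exact hperc'

/-- Relabelling twice by the point reflection is the identity. [folklore] -/
theorem relabel_reflect_relabel_reflect (c : Site 2) (ω : BondConfig (Site 2)) :
    BondConfig.relabel (sym2Equiv (Equiv.subLeft c)) (BondConfig.relabel (sym2Equiv (Equiv.subLeft c)) ω) = ω := by
  ext e
  simp only [BondConfig.mem_relabel_iff, sym2Equiv_symm, sym2Equiv_apply, Sym2.map_map]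
  have h : (⇑(Equiv.subLeft c).symm ∘ ⇑(Equiv.subLeft c).symm) = id := by
    funext x; simp [neg_add_eq_sub]
  rw [h, Sym2.map_id, id]

/-- **Reflecting the dual exit event**: `ω ↦ (2k, 2k) - ω` carries `dExit` through the side `i + 3`
onto `dExit` through the side `i`. [cite: BollobasRiordan2006, Ch. 5, proof of Thm. 11 (p. 137)] -/
theorem preimage_relabel_reflect_dExit (k : ℕ) (i : Fin 6) :
    BondConfig.relabel (sym2Equiv (Equiv.subLeft (![2 * (k : ℤ), 2 * k] : Site 2))) ⁻¹'
        dExit (hexFinset k) (hexSide k i) =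
      dExit (hexFinset k) (hexSide k (i + 3)) := by
  ext ω
  rw [Set.mem_preimage]
  refine ⟨dExit_of_relabel_reflect, fun h => ?_⟩
  have h3 : i + 3 + 3 = i := by rw [add_assoc]; exact add_eq_left.2 (by decide)
  rw [← relabel_reflect_relabel_reflect (![2 * (k : ℤ), 2 * k]) ω] at h
  have := dExit_of_relabel_reflect h
  rwa [h3] at this

/-- **Opposite dual exit events have the same probability.** [cite: BollobasRiordan2006, Ch. 5, proof of Thm. 11 (p. 137)] -/
theorem real_dExit_add_three (p : unitInterval) (k : ℕ) (i : Fin 6) :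
    (bondPercolation triGraph p).real (dExit (hexFinset k) (hexSide k (i + 3))) =
      (bondPercolation triGraph p).real (dExit (hexFinset k) (hexSide k i)) := by
  rw [← preimage_relabel_reflect_dExit k i]
  exact bondPercolation_real_preimage_relabel_iso (G := triGraph) (G' := triGraph)
    { toEquiv := Equiv.subLeft (![2 * (k : ℤ), 2 * k] : Site 2),
      map_rel_iff' := fun {a b} => triGraph_adj_reflect_iff k a b } p _

end

end BondTri

end Literature.Probability.Percolation
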